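import Literature.Analysis.FluidPDE.PineauVicolRSSHolds
import HarnessLib

/-!
# Compactness of Type I RSS solutions at a general rotation speed: the extraction step

Summit `NavierStokesRegularity`, crux `TypeICertificateLadder.NoTypeIBlowup`, line
`killing-twisted-bernoulli-solitons`. The Chae–Wolf 2017, §3 compactness argument for rotated
self-similar (RSS, Pineau–Vicol 2026, (1.7)) Type I classical Navier–Stokes solutions, run with
rotation speeds `α_n → α₀` (an arbitrary limit speed) and Type I constants `C_n → C⋆`, `C_n ≤ C₀`:
a subsequence of the ansatz fields converges locally uniformly on `(−∞, −1/4] × ℝ³` to a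
continuous Type I (constant `C⋆`) bounded weak solution which is RSS-symmetric with speed `α₀` —
`v(t,x) = μ R(2α₀ log μ) v(μ²t, μ R(−2α₀ log μ) x)` for every `μ ≥ 1` — and nontrivial at time
`−1`. This is the tree's `PineauVicol2026.exists_limit_rss` (the case `α₀ = 0`, constant
constants) with the rotation angles `2α_n log μ → 2α₀ log μ` kept in the limit.

## References

* D. Chae, J. Wolf, *Removing discretely self-similar singularities for the 3D Navier–Stokes
  equations*, Comm. PDE 42 (2017) 1359–1374 = arXiv:1610.09464, §3 (Step 2).
* B. Pineau, V. Vicol, *On rotated backwards self-similar solutions of the incompressible 3D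
  Navier–Stokes equations*, arXiv:2607.09619 (2026), §1.2 (definition of RSS), Remark 1.2.
-/

set_option linter.dupNamespace false

noncomputable section

open Set Function Filter MeasureTheory Metric
open scoped Topology NNReal

namespace Summit.NavierStokesRegularity.NavierStokesRegularity.Theorems

open Literature.Analysis.FluidPDE Literature.Analysis.FluidPDE.PineauVicol2026

/-! ### Rotations about the axis: continuity in the angle, general limit angle -/

/-- The orbit map `θ ↦ R_θ z` of a point under the rotations about the axis is continuous
(private copy of the tree's `continuous_rotZ_angle`, kept here with a light import). -/
private theorem rssCompact_continuous_rotZ_angle (z : EuclideanSpace ℝ (Fin 3)) :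
    Continuous fun θ : ℝ => rotZ θ z := by
  -- adapted from Literature/Analysis/FluidPDE/PineauVicolRSSHolds.lean (continuous_rotZ_angle')
  unfold rotZ
  refine (PiLp.continuous_toLp 2 _).comp ?_
  refine continuous_pi fun i => ?_
  have hc : Continuous fun θ : ℝ => Real.cos θ := Real.continuous_cos
  have hs : Continuous fun θ : ℝ => Real.sin θ := Real.continuous_sin
  fin_cases i
  · exact ((hc.mul (continuous_const (y := z 0))).sub
      (hs.mul (continuous_const (y := z 1)))).congr fun θ => by simp
  · exact ((hs.mul (continuous_const (y := z 0))).add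
      (hc.mul (continuous_const (y := z 1)))).congr fun θ => by simp
  · exact (continuous_const (y := z 2)).congr fun θ => by simp

/-- Rotations by convergent angles of a convergent sequence converge:
`θ_n → θ₀`, `z_n → z₀` imply `R_{θ_n} z_n → R_{θ₀} z₀` (each `R_θ` is an isometry, and the orbit
map `θ ↦ R_θ z₀` is continuous). -/
theorem rssCompact_tendsto_rotZ_of_tendsto {θ : ℕ → ℝ} {θ₀ : ℝ}
    {z : ℕ → EuclideanSpace ℝ (Fin 3)} {z₀ : EuclideanSpace ℝ (Fin 3)}
    (hθ : Tendsto θ atTop (𝓝 θ₀)) (hz : Tendsto z atTop (𝓝 z₀)) :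
    Tendsto (fun n => rotZ (θ n) (z n)) atTop (𝓝 (rotZ θ₀ z₀)) := by
  -- adapted from Literature/Analysis/FluidPDE/PineauVicolRSSHolds.lean (tendsto_rotZ_of_tendsto)
  rw [tendsto_iff_norm_sub_tendsto_zero] at hz ⊢
  have h1 : Tendsto (fun n => rotZ (θ n) z₀) atTop (𝓝 (rotZ θ₀ z₀)) :=
    ((rssCompact_continuous_rotZ_angle z₀).tendsto θ₀).comp hθ
  have h1' := tendsto_iff_norm_sub_tendsto_zero.1 h1
  have hbound : ∀ n, ‖rotZ (θ n) (z n) - rotZ θ₀ z₀‖ ≤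
      ‖z n - z₀‖ + ‖rotZ (θ n) z₀ - rotZ θ₀ z₀‖ := fun n => by
    calc ‖rotZ (θ n) (z n) - rotZ θ₀ z₀‖
        ≤ ‖rotZ (θ n) (z n) - rotZ (θ n) z₀‖ + ‖rotZ (θ n) z₀ - rotZ θ₀ z₀‖ :=
          norm_sub_le_norm_sub_add_norm_sub _ _ _
      _ = ‖z n - z₀‖ + ‖rotZ (θ n) z₀ - rotZ θ₀ z₀‖ := by
          congr 1
          rw [← rotZL_apply (θ n) (z n), ← rotZL_apply (θ n) z₀, ← map_sub, rotZL_apply,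
            norm_rotZ]
  refine squeeze_zero (fun n => norm_nonneg _) hbound ?_
  simpa using hz.add h1'

/-! ### The extraction at a general limit speed `α₀` -/

/-- **The compactness step (Chae–Wolf 2017, §3, Step 2, run with `α_n → α₀`, `C_n → C⋆`).**
Let `w_n` be the RSS ansatz fields (1.7) with speeds `α_n → α₀` and time-independent profiles
`U_n ≠ 0`, each a classical Navier–Stokes solution (`ν = 1`, `f = 0`) on `ℝ³ × (−∞, 0)` obeying
the Type I bound `‖w_n(t,x)‖ ≤ C_n/(‖x‖ + √(−t))` with `0 ≤ C_n ≤ C₀`, `C_n → C⋆`. Then a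
subsequence converges, locally uniformly on `(−∞, −1/4] × ℝ³` (uniform Lipschitz bounds
`ChaeWolf.exists_uniform_lipschitz` for the common constant `C₀` and the pointwise Arzelà–Ascoli
theorem `exists_strictMono_tendsto_of_lipschitzWith`), to a continuous field `v` with the Type I
bound of constant `C⋆`, which is a bounded weak Navier–Stokes solution on `(−∞, −1/4)` (written
for `t ↦ v(t − 1/4)` on `(−∞, 0)`), is **rotated self-similar with speed `α₀`** —
`v(t,x) = μ R(θ₀) v(μ²t, μ R(−θ₀) x)`, `θ₀ = 2α₀ log μ`, for every `μ ≥ 1`, because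
`w_n(t,x) = μ R(θ_n) w_n(μ²t, μR(−θ_n)x)` with `θ_n = 2α_n log μ → θ₀`
(`pvAnsatz_rss_eq_smul_rotZ`, equicontinuity, `rssCompact_tendsto_rotZ_of_tendsto`) — and
**nontrivial at time `−1`** (smallness lemma `ChaeWolf.exists_eps_typeI_small_eq_zero`, the size
identity `√(−t)|w_n(t,x)| = |U_n(y)|`, the profile bound (1.9) and `w_n(−1, ·) = U_n`). -/
theorem rssCompact_exists_limit :
    ∀ (C₀ Cstar α₀ : ℝ) (C α : ℕ → ℝ)
      (U : ℕ → EuclideanSpace ℝ (Fin 3) → EuclideanSpace ℝ (Fin 3))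
      (P : ℕ → ℝ → EuclideanSpace ℝ (Fin 3) → ℝ),
      0 < C₀ → (∀ n, 0 ≤ C n) → (∀ n, C n ≤ C₀) → Tendsto C atTop (𝓝 Cstar) →
      Tendsto α atTop (𝓝 α₀) →
      (∀ n, Literature.Analysis.FluidPDE.IsClassicalNSSolutionOn (Iio 0) 1 0
        (Literature.Analysis.FluidPDE.pvAnsatz (α n) (fun y _ => U n y)) (P n)) →
      (∀ n, Literature.Analysis.FluidPDE.HasTypeIDecay (C n)
        (Literature.Analysis.FluidPDE.pvAnsatz (α n) (fun y _ => U n y))) →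
      (∀ n, U n ≠ 0) →
      ∃ v : ℝ → EuclideanSpace ℝ (Fin 3) → EuclideanSpace ℝ (Fin 3), Continuous (uncurry v) ∧
        (∀ t ≤ -(1 / 4 : ℝ), ∀ x, ‖v t x‖ ≤ Cstar / (‖x‖ + √(-t))) ∧
        Literature.Analysis.FluidPDE.IsBoundedWeakNSSolutionOn (Iio 0) isOpen_Iio 1
          (fun t => v (t - 1 / 4)) ∧
        (∀ μ : ℝ, 1 ≤ μ → ∀ t ≤ -(1 / 4 : ℝ), ∀ x,
          v t x = μ • Literature.Analysis.FluidPDE.rotZ (α₀ * (2 * Real.log μ))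
            (v (μ ^ 2 * t)
              (μ • Literature.Analysis.FluidPDE.rotZ (-(α₀ * (2 * Real.log μ))) x))) ∧
        ∃ x : EuclideanSpace ℝ (Fin 3), v (-1) x ≠ 0 := by
  -- adapted from Literature/Analysis/FluidPDE/PineauVicolRSSHolds.lean (exists_limit_rss)
  intro C₀ Cstar α₀ C α U P hC₀ _hC0 hCle hC hα hcl hI hnt
  -- the RSS fields
  set w : ℕ → ℝ → EuclideanSpace ℝ (Fin 3) → EuclideanSpace ℝ (Fin 3) :=
    fun n => pvAnsatz (α n) (fun y _ => U n y) with hw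
  -- the Type I bounds with the common constant `C₀`
  have hI' : ∀ n, HasTypeIDecay C₀ (w n) := fun n t ht x =>
    (hI n t ht x).trans (div_le_div_of_nonneg_right (hCle n) (by positivity))
  obtain ⟨K, L, hK, hL, hKL⟩ := ChaeWolf.exists_uniform_lipschitz hC₀.le
  obtain ⟨ε₀, hε₀, hA⟩ := ChaeWolf.exists_eps_typeI_small_eq_zero
  -- the profile bound (1.9) from the Type I bound at `t = -1` (Remark 1.2)
  have hUb : ∀ n (y : EuclideanSpace ℝ (Fin 3)), ‖U n y‖ ≤ C₀ / (‖y‖ + 1) := fun n =>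
    profile_bound_of_typeI (α := α n) (u := w n) (fun t ht x => hI' n t ht.2 x) fun _ _ _ => rfl
  -- Step 1 (nontriviality survives at the fixed time `-1`)
  have hwit : ∀ n, ∃ y : EuclideanSpace ℝ (Fin 3),
      ‖y‖ ≤ C₀ / ε₀ ∧ ε₀ ≤ ‖w n (-1) y‖ := by
    intro n
    -- a point with a large scale-invariant size, by the smallness lemma
    obtain ⟨t', ht', x', hq'⟩ : ∃ t' < 0, ∃ x', ε₀ < √(-t') * ‖w n t' x'‖ := by
      by_contra hcon
      push Not at hcon
      have hzero := hA hC₀.le (hcl n) (hI' n) hcon (-1) (by norm_num)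
      refine hnt n (funext fun y => ?_)
      simpa [pvAnsatz_neg_one] using hzero y
    -- in terms of the profile: `√(-t') ‖w n t' x'‖ = ‖U n y'‖`
    have hs : 0 < √(-t') := Real.sqrt_pos.2 (by linarith)
    set y' : EuclideanSpace ℝ (Fin 3) :=
      rotZ (-(α n * -Real.log (-t'))) ((√(-t'))⁻¹ • x') with hy'
    have hUy : ε₀ < ‖U n y'‖ := by
      have e : √(-t') * ‖w n t' x'‖ = ‖U n y'‖ := by
        rw [show w n t' x' = pvAnsatz (α n) (fun y _ => U n y) t' x' from rfl, norm_pvAnsatz,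
          ← mul_assoc, mul_inv_cancel₀ hs.ne', one_mul]
      rwa [e] at hq'
    refine ⟨y', ?_, ?_⟩
    · have h1 : ε₀ < C₀ / (‖y'‖ + 1) := hUy.trans_le (hUb n y')
      rw [lt_div_iff₀ (by positivity)] at h1
      rw [le_div_iff₀ hε₀]
      nlinarith [norm_nonneg y', hε₀]
    · rw [show w n (-1) y' = U n y' from pvAnsatz_neg_one _ _ _]
      exact hUy.le
  -- the equi-Lipschitz family on `ℝ × ℝ³` (fields frozen at time `-1/4` for later times)
  set Kx : ℝ≥0 := (K + L).toNNReal with hKx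
  have hKx' : (Kx : ℝ) = K + L := by rw [hKx, Real.coe_toNNReal _ (by positivity)]
  set f : ℕ → ℝ × EuclideanSpace ℝ (Fin 3) → EuclideanSpace ℝ (Fin 3) :=
    fun n q => w n (min q.1 (-(1 / 4 : ℝ))) q.2 with hf
  have hf_of_le : ∀ n {t : ℝ} (_ : t ≤ -(1 / 4 : ℝ)) (x : EuclideanSpace ℝ (Fin 3)),
      f n (t, x) = w n t x :=
    fun n t ht x => by simp only [hf, min_eq_left ht]
  have hlip : ∀ n, LipschitzWith Kx (f n) := by
    intro n
    obtain ⟨hsp, htm⟩ := hKL (hcl n) (hI' n)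
    refine LipschitzWith.of_dist_le_mul fun q q' => ?_
    rw [hKx', dist_eq_norm, Prod.dist_eq, Real.dist_eq, dist_eq_norm]
    have hm : min q.1 (-(1 / 4 : ℝ)) ≤ -(1 / 4 : ℝ) := min_le_right _ _
    have hm' : min q'.1 (-(1 / 4 : ℝ)) ≤ -(1 / 4 : ℝ) := min_le_right _ _
    have hmin : |min q.1 (-(1 / 4 : ℝ)) - min q'.1 (-(1 / 4 : ℝ))| ≤ |q.1 - q'.1| := by
      refine (abs_min_sub_min_le_max _ _ _ _).trans (max_le le_rfl ?_)
      rw [sub_self, abs_zero]; exact abs_nonneg _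
    calc ‖w n (min q.1 (-(1 / 4))) q.2 - w n (min q'.1 (-(1 / 4))) q'.2‖
        ≤ ‖w n (min q.1 (-(1 / 4))) q.2 - w n (min q.1 (-(1 / 4))) q'.2‖ +
            ‖w n (min q.1 (-(1 / 4))) q'.2 - w n (min q'.1 (-(1 / 4))) q'.2‖ :=
          norm_sub_le_norm_sub_add_norm_sub _ _ _
      _ ≤ K * ‖q.2 - q'.2‖ + L * |min q.1 (-(1 / 4 : ℝ)) - min q'.1 (-(1 / 4 : ℝ))| :=
          add_le_add (hsp _ hm _ _) (htm _ hm' _ hm _)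
      _ ≤ K * max |q.1 - q'.1| ‖q.2 - q'.2‖ + L * max |q.1 - q'.1| ‖q.2 - q'.2‖ := by
          gcongr
          · exact le_max_right _ _
          · exact hmin.trans (le_max_left _ _)
      _ = (K + L) * max |q.1 - q'.1| ‖q.2 - q'.2‖ := by ring
  have hball : ∀ n q, f n q ∈ closedBall (0 : EuclideanSpace ℝ (Fin 3)) (2 * C₀) :=
      fun n q => by
    rw [mem_closedBall, dist_zero_right]
    exact ChaeWolf.typeI_norm_le_two_mul hC₀.le (hI' n) (min_le_right _ _) _
  obtain ⟨φ, l, hφ, hl, -, hlim⟩ := exists_strictMono_tendsto_of_lipschitzWith f hlip hball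
  -- the limit field
  set v : ℝ → EuclideanSpace ℝ (Fin 3) → EuclideanSpace ℝ (Fin 3) := fun t x => l (t, x) with hv
  have hlimv : ∀ {t : ℝ} (_ : t ≤ -(1 / 4 : ℝ)) (x : EuclideanSpace ℝ (Fin 3)),
      Tendsto (fun n => w (φ n) t x) atTop (𝓝 (v t x)) := by
    intro t ht x
    simpa only [hf_of_le _ ht] using hlim (t, x)
  have hvc : Continuous (uncurry v) := by
    have e : uncurry v = l := by funext q; rfl
    rw [e]; exact hl.continuous
  refine ⟨v, hvc, ?_, ?_, ?_, ?_⟩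
  · -- the Type I bounds `C (φ n) → C⋆` pass to the limit
    intro t ht x
    exact le_of_tendsto_of_tendsto' (hlimv ht x).norm ((hC.comp hφ.tendsto_atTop).div_const _)
      fun n => hI (φ n) t (by linarith) x
  · -- bounded weak solution on `(-∞, -1/4)`, shifted to `(-∞, 0)`
    have hA' : Tendsto (fun k : ℕ => -(k : ℝ) + -1) atTop atBot :=
      (tendsto_neg_atTop_atBot.comp tendsto_natCast_atTop_atTop).atBot_add tendsto_const_nhds
    have e14 : ∀ t : ℝ, t - 1 / 4 = t + -(1 / 4 : ℝ) := fun t => by ring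
    have hV : ∀ k : ℕ, IsBoundedWeakNSSolutionOn (Ioo (-(k : ℝ) + -1) 0) isOpen_Ioo 1
        (fun t => w (φ k) (t - 1 / 4)) := by
      intro k
      have hcl' : IsClassicalNSSolutionOn (Ioo (-(k : ℝ) + -1 + -(1 / 4)) (-(1 / 4))) 1 0
          (w (φ k)) (P (φ k)) :=
        (hcl (φ k)).mono (fun t ht => by simp only [mem_Iio]; linarith [ht.2])
          (uniqueDiffOn_Ioo _ _)
      have hbdd : IsBoundedOn (Ioo (-(k : ℝ) + -1 + -(1 / 4)) (-(1 / 4))) (w (φ k)) :=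
        ⟨2 * C₀, fun t ht x => ChaeWolf.typeI_norm_le_two_mul hC₀.le (hI' (φ k)) ht.2.le x⟩
      have h := (hcl'.isBoundedWeakNSSolutionOn hbdd).comp_add_right (-(1 / 4 : ℝ))
        (J := Ioo (-(k : ℝ) + -1) 0) isOpen_Ioo fun t => by
          simp only [mem_Ioo]
          constructor <;> intro h <;> constructor <;> linarith [h.1, h.2]
      simpa only [e14] using h
    have hcont : ∀ k : ℕ, ContinuousOn (uncurry fun t => w (φ k) (t - 1 / 4))
        (Ioo (-(k : ℝ) + -1) 0 ×ˢ univ) := by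
      intro k
      have h1 := ((hcl (φ k)).smooth_velocity.comp_add_right (-(1 / 4 : ℝ))).continuousOn
      refine (h1.mono (prod_mono (fun t ht => ?_) Subset.rfl)).congr fun q _ => by
        simp only [uncurry, e14, hw]
      simp only [mem_preimage, mem_Iio]
      linarith [ht.2]
    have hbd : ∀ k : ℕ, ∀ t ∈ Ioo (-(k : ℝ) + -1) 0, ∀ x,
        ‖w (φ k) (t - 1 / 4) x‖ ≤ 2 * C₀ :=
      fun k t ht x => ChaeWolf.typeI_norm_le_two_mul hC₀.le (hI' (φ k)) (by linarith [ht.2]) x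
    have hvc' : Continuous (uncurry fun t x => v (t - 1 / 4) x) :=
      hvc.comp ((continuous_fst.sub continuous_const).prodMk continuous_snd)
    exact isBoundedWeakNSSolutionOn_of_tendsto hA' hV hcont hbd hvc'
      fun t ht x => hlimv (by linarith) x
  · -- rotated self-similarity of the limit: the angles `2 α_n log μ` tend to `2 α₀ log μ`
    intro μ hμ t ht x
    have hμ0 : 0 < μ := one_pos.trans_le hμ
    have ht0 : t ≤ 0 := by linarith
    set θ₀ : ℝ := α₀ * (2 * Real.log μ) with hθ₀
    set θ : ℕ → ℝ := fun n => α n * (2 * Real.log μ) with hθ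
    have hθlim : Tendsto (fun n => θ (φ n)) atTop (𝓝 θ₀) :=
      (hα.comp hφ.tendsto_atTop).mul_const _
    -- the twisted scaling identity along the sequence
    have hid : ∀ n, w n t x = μ • rotZ (θ n) (w n (μ ^ 2 * t) (μ • rotZ (-(θ n)) x)) :=
      fun n => pvAnsatz_rss_eq_smul_rotZ (α n) (U n) hμ0 t x
    -- the moving points stay in `t ≤ -1/4`
    have hmem : μ ^ 2 * t ≤ -(1 / 4 : ℝ) :=
      (mul_le_of_one_le_left ht0 (one_le_pow₀ hμ)).trans ht
    have hrot : Tendsto (fun n => rotZ (-(θ (φ n))) x) atTop (𝓝 (rotZ (-θ₀) x)) :=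
      ((rssCompact_continuous_rotZ_angle x).tendsto (-θ₀)).comp hθlim.neg
    set q : ℕ → ℝ × EuclideanSpace ℝ (Fin 3) :=
      fun n => (μ ^ 2 * t, μ • rotZ (-(θ (φ n))) x) with hq
    have hqlim : Tendsto q atTop (𝓝 (μ ^ 2 * t, μ • rotZ (-θ₀) x)) :=
      tendsto_const_nhds.prodMk_nhds (hrot.const_smul μ)
    have h1 : Tendsto (fun n => f (φ n) (q n)) atTop
        (𝓝 (v (μ ^ 2 * t) (μ • rotZ (-θ₀) x))) :=
      ChaeWolf.tendsto_apply_of_tendsto (fun n => hlip (φ n)) hqlim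
        (hlim (μ ^ 2 * t, μ • rotZ (-θ₀) x))
    have h1' : Tendsto (fun n => w (φ n) (μ ^ 2 * t) (μ • rotZ (-(θ (φ n))) x)) atTop
        (𝓝 (v (μ ^ 2 * t) (μ • rotZ (-θ₀) x))) := by
      refine h1.congr fun n => ?_
      simp only [hq, hf_of_le _ hmem]
    have h2 : Tendsto
        (fun n => rotZ (θ (φ n)) (w (φ n) (μ ^ 2 * t) (μ • rotZ (-(θ (φ n))) x))) atTop
        (𝓝 (rotZ θ₀ (v (μ ^ 2 * t) (μ • rotZ (-θ₀) x)))) :=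
      rssCompact_tendsto_rotZ_of_tendsto hθlim h1'
    have h3 : Tendsto (fun n => w (φ n) t x) atTop
        (𝓝 (μ • rotZ θ₀ (v (μ ^ 2 * t) (μ • rotZ (-θ₀) x)))) := by
      refine (h2.const_smul μ).congr fun n => ?_
      exact (hid (φ n)).symm
    exact tendsto_nhds_unique (hlimv ht x) h3
  · -- nontriviality at time `-1`
    choose y hyb hyw using hwit
    have hSc : IsCompact (closedBall (0 : EuclideanSpace ℝ (Fin 3)) (C₀ / ε₀)) :=
      isCompact_closedBall _ _
    have hmemS : ∀ n, y (φ n) ∈ closedBall (0 : EuclideanSpace ℝ (Fin 3)) (C₀ / ε₀) :=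
        fun n => by
      rw [mem_closedBall, dist_zero_right]; exact hyb (φ n)
    obtain ⟨ybar, -, ψ, hψ, hconv⟩ := hSc.tendsto_subseq hmemS
    refine ⟨ybar, fun h0 => ?_⟩
    have h14 : (-1 : ℝ) ≤ -(1 / 4 : ℝ) := by norm_num
    have hy0 : Tendsto (fun n => f (φ (ψ n)) ((-1 : ℝ), ybar)) atTop (𝓝 (v (-1) ybar)) :=
      (hlim ((-1 : ℝ), ybar)).comp hψ.tendsto_atTop
    have hconv' : Tendsto (fun n => ((-1 : ℝ), y (φ (ψ n)))) atTop (𝓝 ((-1 : ℝ), ybar)) :=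
      tendsto_const_nhds.prodMk_nhds hconv
    have hmain := ChaeWolf.tendsto_apply_of_tendsto (fun n => hlip (φ (ψ n))) hconv' hy0
    have hge : ε₀ ≤ ‖v (-1) ybar‖ := by
      refine ge_of_tendsto' hmain.norm fun n => ?_
      simp only [hf_of_le _ h14]
      exact hyw (φ (ψ n))
    rw [h0, norm_zero] at hge
    linarith

end Summit.NavierStokesRegularity.NavierStokesRegularity.Theorems

end
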